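import Summits.BirchSwinnertonDyer.BirchSwinnertonDyer.Theorems.EisensteinPrimesGoodLatticeBDPValueOfNamedFactsV27
import Summits.BirchSwinnertonDyer.BirchSwinnertonDyer.Theorems.EisensteinPrimesGoodLatticeBDPValueOfKatzUnitOfTate
import Summits.BirchSwinnertonDyer.BirchSwinnertonDyer.Theorems.EisensteinPrimesAcTwistDeformationImprimCorankOfTateTC
import Summits.BirchSwinnertonDyer.BirchSwinnertonDyer.Theorems.EisensteinPrimesGoodLatticeBDPValuePublishedFactsOfTextbookTC
import Literature.NumberTheory.GaloisCohomology.RestrictedRamificationPoitouTateThreeLeTotallyComplex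
import HarnessLib
/-!
# Crux `GoodLatticeBDPValue` (stmt-BirchSwinnertonDyer-19032), line `halves`: THE CRUX BY NAME FROM NINE LITERATURE NAMED FACTS —
# HARARI 17.13 (a) DISCHARGED (tree theorem at totally complex fields, lane PT3-TC) and MILNE I 5.1 AT TOTALLY COMPLEX FIELDS ONLY;
# the by-name closure of the LEAD's skeleton v28 (lane «T28 / TATE RE-PLUMB»)

Cell `bsd-eis` (run/shared/lean/pub/bsd-eis/), LEAD seat `bsd-line-x1-p1` gen 8. `--supports stmt-BirchSwinnertonDyer-19032`.

On the v27 surface (`GoodLatticeBDPValueOfNamedFactsV27.goodLatticeBDPValue_of_namedFacts₂₇`, p674669) the crux BY NAME is conditional on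
TEN Literature named facts, two of them textbook duality theorems quantified over EVERY number field: Milne ADT I Thm. 5.1
(`tateGlobalEulerPoincareCharacteristic`) and Harari Thm. 17.13 (a) (`poitouTate_restricted_three_le`).  The universal quantifier on the
second was forced by ONE consumer: w2 gen 6's `publishedFactsGreenberg_of_textbook` derives Greenberg 2006 Prop. 3.2
(`prop32_cohomology_isCofinitelyGenerated`, cofinite generation of `Hⁱ(K_Σ/K, 𝒟)` in EVERY degree at EVERY number field) from the two
facts, and at fields with real places the finiteness of `Hⁱ(G_S, α)`, `i ≥ 3`, is Poitou–Tate.  Lane T28 (this seat, head-on):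

1. every `.global` read of Prop. 3.2 on the line is in degree `i ≤ 2` (`AcTwistDeformationLEO` i = 2, `…GreenbergFullAtSqueeze` i = 1,
   `WeakLeopoldtAbove` i = 2), the local clause is the unconditional `Greenberg2006.prop32_local_holds`, and Greenberg's dévissage for
   `Hⁿ` involves `Hⁿ`, `Hⁿ⁻¹` only (tree: `ContinuousRep.module_finite_characterModule_continuousCohomology_of_le`); so Prop. 3.2 AS
   CONSUMED follows from Milne I 5.1 ALONE for every number field — `GaloisCohomology.finite_continuousCohomology_of_prime_of_tate_le_two`
   (p677318), `Greenberg2006.prop32_global_le_two_of_tate` (p677794);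
2. the theorems of the line carrying Prop. 3.2 by name were RE-TYPED token for token against
   `∀ L [IsTotallyComplex L], tateGlobalEulerPoincareCharacteristic L` (18 files `Theorems/…OfTateTC.lean`; an `[IsTotallyComplex K]` binder
   added where the field was not syntactically totally complex; in the no-pseudo-null chain — 4 files `…OfTate.lean` — the hypothesis is
   simply dropped);
3. Greenberg 2006 Prop. 4.1 is TYPED totally imaginary and follows from the two facts at totally complex fields
   (`Greenberg2006.prop41_of_tate_of_poitouTate_three_le_of_isTotallyComplex`, p677647); `cd_p(G_{K,Σ}) ≤ 2` and the `H²` bookkeeping of stub 2a-I are read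
   at the imaginary quadratic `K` (`GoodLatticeBDPValuePublishedFactsOfTextbookTC.indexInputs_of_textbook_tc`).

Result: `goodLatticeBDPValue_of_namedFacts₂₈ : ⟨proofThm422 ∧ thm513_disc ∧ thm331 ∧ thmII64⟩ → thm222_anacong_goodLattice_of_fullDescentDatum →
⟨prop411 ∧ (∀ L [IsTotallyComplex L], tateGlobalEulerPoincareCharacteristic L)⟩ → ⟨prop263 ∧ thm212⟩ → Theses.EisensteinPrimes.GoodLatticeBDPValue` —
₂₇'s hypotheses with HARARI 17.13 (a) GONE (supplied inside by the tree theorem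
`GaloisCohomology.forall_poitouTate_restricted_three_le_of_isTotallyComplex`, lane PT3-TC, w8 gen 9 (A5) p681302: class-formation road
`RestrictedRamificationPoitouTateThreeLeOfCdTwo` p675005, `CohomologicalDimensionOpenSubgroupCriterion` p675422, `RestrictedRamificationCdTwoOfH3Mu` p675904,
(A1)–(A5) with bricks by w5 g6, w4 g16, w6 g8, w7 g7–g8, w3 g13–g15, w2 g8) and MILNE I 5.1 RESTRICTED TO TOTALLY COMPLEX FIELDS, i.e. to exactly
the statement the tree's other class-formation road targets (lane TATE-EPC-TC, w5 gen 7, ORDER OF WORK v1 00:18Z, bricks B0–B8). NINE names; when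
that road lands, EIGHT.  Composition = v25's (`…OfNamedFactsV25`) with the T28
consumers: `publishedFactsGreenberg_of_textbook_tc` (seven Greenberg-type facts, no Prop. 3.2), [AN] from 3a-A BY NAME at both odd-`p`
slices (`thm222_OPEN_of_fullDescentDatum_of_five_le` with the T‴ bridge `thm222_anacong_goodLattice_of_five_le_of_fullDescentDatum`),
the re-typed terminal consumer `…_of_katzUnit_ofTate`, [ALG-imp-λ] via `imprimLambdaLE_of_facts_tc` (inputs `indexInputs_of_textbook_tc`,
mid-level `zpCorank_datumStrictSelmer_add_eq`, plumbing `IndexPlumbingNrVsStrict.lambdaInvariant_add_le_of_mid`), the prop125 chain on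
`prop125_residualPair_unrSelmer_corank_ge_of_facts_ofTate`, `FSideCorankLe.stub_fSideCorankLe`, `anQ_of_thm222_OPEN`.

HONEST FRAMING: CONDITIONAL on exactly these ten names (research 7: CGLS 2022 proof of Thm. 4.2.2, Thm. 5.1.3 (disc), Thm. 2.1.2; Bleher et
al. 2020 Thm. 3.3.1; de Shalit 1987 II.6.4; Greenberg 2016 Props. 4.1.1, 2.6.3; composed-print 1: `_of_fullDescentDatum` (label under
referee C3 review); textbook 1: Milne ADT I 5.1 at totally complex fields; Harari 17.13 (a) is a tree theorem at those fields); closes nothing by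
itself; the v28 reshape is the LEAD's call (W-79); no summit statement / BSD / Mazur MC / IMC2 / KY 2.2.2 is proved for any curve.
[claim: KellerYin2024, status: under-review]
[cite: KellerYin2024, Thm. 3.0.8 (IMC2) and proof (arXiv:2402.12781v2 TeX L1631–1640), Thm. 1.4.1, proof of Thm. 1.5.1, Thms. 2.2.1–2.2.3]
[cite: CastellaGrossiLeeSkinner2022, proof of Thm. 4.2.2, Thm. 5.1.3 with (disc), Thm. 2.1.2, Thms. 2.2.1/2.2.2 with (2.16), Prop. 1.2.5]
[cite: Kriz2016, Thm. 3, Def. 31 (5), Rem. 33, Thm. 34 (3), Thm. 35] [cite: BleherEtAl2020, §3.3 Thm. 3.3.1] [cite: deShalit1987, II.6.4 Theorem (i)]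
[cite: Greenberg2016Selmer, Prop. 4.1.1, Prop. 2.6.3] [cite: Greenberg2006, Props. 3.2, 4.1, 4.2, §5 A]
[cite: MilneADT2006, I Thm. 5.1 (p. 67)] [cite: Harari2020, Thm. 17.13 (a), Cor. 17.14 (pp. 294–295)] [cite: PollackWeston2011, App. A Prop. A.2]
-/

noncomputable section

namespace Summit.BirchSwinnertonDyer.BirchSwinnertonDyer.Theorems.GoodLatticeBDPValueOfNamedFactsV28

open scoped Classical

open PowerSeries
  WeierstrassCurve
  NumberField
  IsDedekindDomain
  Field
  Literature.NumberTheory.GaloisRepresentations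
  Literature.NumberTheory.EllipticCurves.GreenbergVatsal2000
  Summit.BirchSwinnertonDyer.BirchSwinnertonDyer.Theorems.EisensteinPrimesMuLambda
  Literature.NumberTheory.EllipticCurves
  Literature.NumberTheory.EllipticCurves.ModularForms
  Literature.NumberTheory.EllipticCurves.Rank1Residual
  Literature.NumberTheory.EllipticCurves.Castella2018
  Literature.NumberTheory.EllipticCurves.GreenbergSelmer
  Literature.NumberTheory.QuadraticFields
  Literature.NumberTheory.EllipticCurves.CastellaGrossiLeeSkinner2022
  Literature.NumberTheory.EllipticCurves.KellerYin2024
  Literature.NumberTheory.EllipticCurves.IwasawaAlgebra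
  Literature.NumberTheory.EllipticCurves.Rubin1991
  Literature.NumberTheory.EllipticCurves.DeShalit1987
  Literature.NumberTheory.EllipticCurves.Hida2010MuInvariant
  Literature.NumberTheory.EllipticCurves.BCGKPST2020
  Literature.NumberTheory.IwasawaTheory
  Literature.NumberTheory.IwasawaTheory.Greenberg2016
  Literature.NumberTheory.IwasawaTheory.Greenberg2006
  Summit.BirchSwinnertonDyer.BirchSwinnertonDyer.Theorems
  Summit.BirchSwinnertonDyer.Rank1Residual.X1.KellerYinHalves
  Summit.BirchSwinnertonDyer.Rank1Residual.X2.ResidualDevissageModules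
  Summit.BirchSwinnertonDyer.Rank1Residual.X1.KellerYinMuLambdaSplitDSFree
  Summit.BirchSwinnertonDyer.BirchSwinnertonDyer.Theorems.GoodLatticeBDPValueHalves
  Summit.BirchSwinnertonDyer.BirchSwinnertonDyer.Theorems.GoodLatticeBDPValueOfImprimitive
  Summit.BirchSwinnertonDyer.BirchSwinnertonDyer.Theorems.GoodLatticeBDPValueOfOneInequality
  Summit.BirchSwinnertonDyer.BirchSwinnertonDyer.Theorems.GoodLatticeImprimitiveOfQuotient
  Summit.BirchSwinnertonDyer.BirchSwinnertonDyer.Theorems.GoodLatticeQuotientOfCorank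
  Summit.BirchSwinnertonDyer.BirchSwinnertonDyer.Theorems.GoodLatticeCorankOfGe
  Summit.BirchSwinnertonDyer.BirchSwinnertonDyer.Theorems.GoodLatticeBDPValueOfNamedFactsV23
  Literature.NumberTheory.GaloisCohomology

/-! ### [ALG-imp-λ] glue, Poitou–Tate at totally complex fields -/
/-- **[ALG-imp-λ] in cotorsion `≤` form from Greenberg 2016 Prop. 2.6.3, Milne ADT I 5.1 and Harari 17.13 (a), BOTH AT
TOTALLY COMPLEX FIELDS** — v25's `imprimLambdaLE_of_facts` (and the skeleton's `imprimLambdaLE_of_index`) with the inputs supplied by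
`GoodLatticeBDPValuePublishedFactsOfTextbookTC.indexInputs_of_textbook_tc` (T28: Greenberg 2006 Prop. 3.2 read in degrees `≤ 2` from Tate's
formula; Prop. 4.1 from `prop41_of_tate_of_poitouTate_three_le_of_isTotallyComplex`; `cd_p ≤ 2` at the imaginary quadratic `K`), the mid-level identity
`ResidualIndexAssembly.zpCorank_datumStrictSelmer_add_eq` and the plumbing `IndexPlumbingNrVsStrict.lambdaInvariant_add_le_of_mid`; the
Greenberg-type facts by name are not arguments any more (the plumbing never read them).
[cite: KellerYin2024, Thm. 1.4.1 (iii)] [cite: Greenberg2016Selmer, Prop. 2.6.3] [cite: MilneADT2006, I Thm. 5.1] [cite: Harari2020, Thm. 17.13 (a), Cor. 17.14]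
[cite: Greenberg2006, §5 A, Props. 4.1, 4.2] -/
theorem imprimLambdaLE_of_facts_tc
    (h263 : prop263_sur_of_crk)
    (hEPC : ∀ (L : Type) [Field L] [NumberField L] [IsTotallyComplex L],
      Literature.NumberTheory.GaloisCohomology.tateGlobalEulerPoincareCharacteristic L)
    (hPT3 : ∀ (L : Type) [Field L] [NumberField L] [IsTotallyComplex L],
      Literature.NumberTheory.GaloisCohomology.poitouTate_restricted_three_le L) :
    ∀ (W : WeierstrassCurve ℚ) [W.IsElliptic] [W.IsGloballyMinimal] (p : ℕ) [Fact p.Prime],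
      2 < p → Good W p → Red W p → Anom W p →
      (∀ Φ : AddSubgroup (geomTorsion W (p : ℤ)), IsRationalLine W p Φ → ¬ LineUnramifiedAt W p Φ) →
      ∀ (K : Type) [Field K] [NumberField K], IsImaginaryQuadratic K →
        SatisfiesHeegnerHypothesis (W.conductorNorm ℤ) K → SatisfiesHeegnerHypothesis p K →
        (∀ Q : (W.baseChange K).toAffine.Point, p • Q = 0 → Q = 0) →
      ∀ (ι : K →+* ℚ_[p]) (v vbar : HeightOneSpectrum (𝓞 K)),
        (∀ x : 𝓞 K, x ∈ v.asIdeal ↔ ‖ι (x : K)‖ < 1) →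
        ((p : ℕ) : 𝓞 K) ∈ vbar.asIdeal → vbar ≠ v →
      ∀ (κ : ZpExtension K p), κ.IsAnticyclotomic →
      ∀ (γ : absoluteGaloisGroup K) [Fact (κ.IsTopGenerator γ)],
      ∀ (θsub θquot : FramedGaloisRep K (padicCoeffIntegers (∅ : Set (PadicAlgCl p))) 1),
        IsResidualPairOver (W.baseChange K) p θsub θquot →
      ∀ (Sf : Finset (HeightOneSpectrum (𝓞 K))),
        (∀ w : HeightOneSpectrum (𝓞 K), w ∈ Sf ↔ ((W.conductorNorm ℤ : ℤ) : 𝓞 K) ∈ w.asIdeal) →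
      ∀ (DSsub : DatumDualData κ γ (charModule ∅ θsub)
          (AcSelmer.bdpData (charModule ∅ θsub) p vbar) (↑Sf : Set (HeightOneSpectrum (𝓞 K))))
        (DSquot : DatumDualData κ γ (charModule ∅ θquot)
          (AcSelmer.bdpData (charModule ∅ θquot) p vbar) (↑Sf : Set (HeightOneSpectrum (𝓞 K)))),
      Module.Finite (IwasawaAlgebra p) (AcSelmer.XAc (W.baseChange K) p κ vbar (↑Sf : Set (HeightOneSpectrum (𝓞 K))) γ) →
      Module.IsTorsion (IwasawaAlgebra p) (AcSelmer.XAc (W.baseChange K) p κ vbar (↑Sf : Set (HeightOneSpectrum (𝓞 K))) γ) →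
      muInvariant p (AcSelmer.XAc (W.baseChange K) p κ vbar (↑Sf : Set (HeightOneSpectrum (𝓞 K))) γ) = 0 →
      (∀ D : DatumDualData κ γ (charModule ∅ θsub)
          (AcSelmer.bdpData (charModule ∅ θsub) p vbar) (↑Sf : Set (HeightOneSpectrum (𝓞 K))),
        Module.Finite (IwasawaAlgebra p) D.X ∧ Module.IsTorsion (IwasawaAlgebra p) D.X ∧ muInvariant p D.X = 0) →
      (∀ D : DatumDualData κ γ (charModule ∅ θquot)
          (AcSelmer.bdpData (charModule ∅ θquot) p vbar) (↑Sf : Set (HeightOneSpectrum (𝓞 K))),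
        Module.Finite (IwasawaAlgebra p) D.X ∧ Module.IsTorsion (IwasawaAlgebra p) D.X ∧ muInvariant p D.X = 0) →
      lambdaInvariant p DSsub.X + lambdaInvariant p DSquot.X ≤
        lambdaInvariant p (AcSelmer.XAc (W.baseChange K) p κ vbar (↑Sf : Set (HeightOneSpectrum (𝓞 K))) γ) +
          (if ∀ σ : absoluteGaloisGroup K, θquot σ = 1 then 1 else 0) := by
  intro W _ _ p _ hp hgood hred hanom hlat K _ _ hK hH hHp htor ι v vbar hv hvbar hne κ hκ γ _ θsub θquot hpair Sf hSf
    DSsub DSquot hfgS htorS hμS hSsub hSquot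
  obtain ⟨c, τ, Φ, j₁, j₃, hj₁, hj₃, hτ, hdist, hreps₁, hreps₂, hreps₃, hj₁inj, hj₃inj, hr₁, hr₃, hr₂, hd₂, hUi, hU₁, hU₂,
    hU₃, hsur₁, hsur₂, hsur₃, hprim₁, hprim₂, hprim₃, hfin₁, hfin₂, hfin₃, hinv₁, hinv₂, hinv₃, hN₂, hfinq, hε, hN₁D,
    htrivD, hfinQ, hN₃, hinvD₁, hinvD₃, hH2⟩ :=
    GoodLatticeBDPValuePublishedFactsOfTextbookTC.indexInputs_of_textbook_tc h263 hEPC hPT3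
      W p hp hgood hred hanom hlat K hK hH hHp htor ι v vbar hv hvbar hne κ hκ γ θsub θquot hpair Sf hSf hfgS htorS hμS hSsub
      hSquot
  haveI := hfin₁; haveI := hfin₂; haveI := hfin₃; haveI := hfinq; haveI := hfinQ
  haveI hEK : (W.baseChange K).IsElliptic := inferInstanceAs (W.map (algebraMap ℚ K)).IsElliptic
  have hcN₂ : ∀ b : ↥((W.baseChange K).geomTorsion (p : ℤ)), Continuous fun σ : absoluteGaloisGroup K ↦ σ • b :=
    fun b ↦ continuous_of_injective_comp (G := absoluteGaloisGroup K) Subtype.val_injective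
      ((W.baseChange K).continuous_smul_geomPoints (b : geomPoints (W.baseChange K)))
  -- DIV ×3 and LRS: `cd_p(ker κ ⊓ D_v̄) ≤ 1` (w4 gen 3, `AnticyclotomicLocalCdOne`)
  have hneD : ∃ τ ∈ decomp (K := K) vbar, κ τ ≠ 1 :=
    AnticyclotomicLocalCdOne.exists_mem_decomp_apply_ne_one_of_isAnticyclotomic κ vbar hK hp.ne' hκ hvbar
  have hdiv₁ : ∀ y : subgroupH1 (κ.kerSubgroup ⊓ decomp vbar) (charModule ∅ θsub), ∃ y', p • y' = y := fun y ↦ by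
    obtain ⟨y', hy'⟩ := AnticyclotomicLocalCdOne.exists_eq_nsmul_subgroupH1_inf_decomp κ vbar hneD
      (CharResidualSelmerCount.continuous_smul_charModule θsub) (CharResidualSelmerCount.charModule_divisible θsub) y
    exact ⟨y', hy'.symm⟩
  have hdiv₂ : ∀ y : subgroupH1 (κ.kerSubgroup ⊓ decomp vbar) ↥((W.baseChange K).geomPrimaryTorsion p),
      ∃ y', p • y' = y := fun y ↦ by
    obtain ⟨y', hy'⟩ := AnticyclotomicLocalCdOne.exists_eq_nsmul_subgroupH1_inf_decomp κ vbar hneD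
      ((W.baseChange K).continuous_smul_geomPrimaryTorsion p) hd₂ y
    exact ⟨y', hy'.symm⟩
  have hdiv₃ : ∀ y : subgroupH1 (κ.kerSubgroup ⊓ decomp vbar) (charModule ∅ θquot), ∃ y', p • y' = y := fun y ↦ by
    obtain ⟨y', hy'⟩ := AnticyclotomicLocalCdOne.exists_eq_nsmul_subgroupH1_inf_decomp κ vbar hneD
      (CharResidualSelmerCount.continuous_smul_charModule θquot) (CharResidualSelmerCount.charModule_divisible θquot) y
    exact ⟨y', hy'.symm⟩
  have hpQ : ∀ Q : ↥((W.baseChange K).geomTorsion (p : ℤ)), p • Q = 0 := fun Q ↦ by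
    apply Subtype.ext
    have h := (mem_geomTorsion_iff (W.baseChange K) (p : ℤ) (Q : geomPoints (W.baseChange K))).mp Q.2
    rw [AddSubmonoidClass.coe_nsmul, ← natCast_zsmul, h]
    rfl
  have hlrs := AnticyclotomicLocalCdOne.resH1Hom_id_surjective_inf_decomp κ vbar hneD
    (fun a ↦ Φ.continuous_smul_sub hcN₂ a) hcN₂ (fun a ↦ Φ.continuous_smul_quot hcN₂ a)
    (fun n ↦ ⟨1, Φ.incl_injective (by rw [map_nsmul, map_zero, pow_one]; exact hpQ _)⟩)
    Φ.incl Φ.incl_smul Φ.incl_injective Φ.proj Φ.proj_smul Φ.proj_incl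
    (fun b hb ↦ Φ.mem_range_incl_of_proj_eq_zero b hb) Φ.proj_surjective
  -- FIN: `E(K_{∞,w̄})[p^∞]` is finite (w2 gen 3, `AnomalousLocalTorsion`)
  haveI hfinED : Finite {x : ↥((W.baseChange K).geomPrimaryTorsion p) // ∀ g : ↥(κ.kerSubgroup ⊓ decomp vbar), g • x = x} := by
    have hF := AnomalousLocalTorsion.localTowerTorsionFiniteAt_of_isAnticyclotomic W hp.ne' hanom hlat hK
      (IwasawaTwoVariable.natCast_mem_asIdeal_of_norm_iff hv) hvbar hne κ hκ
    haveI := hF.to_subtype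
    refine Finite.of_injective (fun x ↦ (⟨x.1, (FixedPoints.mem_addSubgroup _ _ _).mpr fun g ↦
      x.2 ⟨g.1, by rw [inf_comm]; exact g.2⟩⟩ :
        (FixedPoints.addSubgroup ↥(decomp (K := K) vbar ⊓ κ.kerSubgroup) ↥((W.baseChange K).geomPrimaryTorsion p) :
          Set ↥((W.baseChange K).geomPrimaryTorsion p)))) fun a b h ↦ Subtype.ext ?_
    simpa using congrArg Subtype.val h
  have hmid := ResidualIndexAssembly.zpCorank_datumStrictSelmer_add_eq κ.kerSubgroup p
    (↑Sf : Set (HeightOneSpectrum (𝓞 K))) vbar hvbar Φ.incl Φ.proj Φ.incl_smul Φ.proj_smul Φ.incl_injective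
    Φ.proj_surjective (fun b hb ↦ Φ.mem_range_incl_of_proj_eq_zero b hb) Φ.proj_incl j₁
    (AddSubgroup.inclusion (geomTorsion_le_geomPrimaryTorsion (W.baseChange K) p)) j₃ hj₁ (fun _ _ ↦ rfl) hj₃ hj₁inj
    (AddSubgroup.inclusion_injective _) hj₃inj hr₁ hr₂ hr₃ (CharResidualSelmerCount.charModule_divisible θsub) hd₂
    (CharResidualSelmerCount.charModule_divisible θquot) (fun a ↦ Φ.continuous_smul_sub hcN₂ a) hcN₂
    (fun a ↦ Φ.continuous_smul_quot hcN₂ a) (CharResidualSelmerCount.continuous_smul_charModule θsub)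
    ((W.baseChange K).continuous_smul_geomPrimaryTorsion p) (CharResidualSelmerCount.continuous_smul_charModule θquot)
    hUi hU₁ hU₂ hU₃ c τ hreps₁ hreps₂ hreps₃ hsur₁ hsur₂ hsur₃ hdiv₁ hdiv₂ hdiv₃ hlrs hprim₁ hprim₂ hprim₃ hinv₁ hinv₂ hinv₃
    hN₂ hε hN₁D htrivD hN₃ hinvD₁ hinvD₃ hH2
  haveI := hfgS
  exact IndexPlumbingNrVsStrict.lambdaInvariant_add_le_of_mid W p hp hanom hlat K hK ι v vbar hv hvbar hne κ hκ γ θsub θquot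
    hpair Sf hSf DSsub DSquot c τ hreps₃ hmid htorS hμS hSsub hSquot

/-! ### The crux BY NAME from ten Literature named facts, Harari 17.13 (a) at totally complex fields -/
/-- **THE CRUX BY NAME — `Theses.EisensteinPrimes.GoodLatticeBDPValue` — from NINE LITERATURE NAMED FACTS (the v28 surface): Harari 17.13 (a)
DISCHARGED at totally complex fields by the tree theorem `forall_poitouTate_restricted_three_le_of_isTotallyComplex` (p681302), Milne I 5.1
carried at totally complex fields only.** Hypotheses = LEAD g7's `goodLatticeBDPValue_of_namedFacts₂₇` (p674669) token for token EXCEPT that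
`stub_publishedFactsGreenberg` has TWO conjuncts, the second carrying `[IsTotallyComplex L]`. Composition: seven Greenberg-type facts
(`publishedFactsGreenberg_of_textbook_tc` fed the Poitou–Tate THEOREM: Prop. 4.1 via `prop41_of_tate_of_poitouTate_three_le_of_isTotallyComplex`, BCGKPST §3.3 from Thm. 3.3.1 p661944,
(T4) the unconditional `…StagesDie.weakLeopoldt_H2_subsingleton_above_cyclotomic_of_isOpen_holds` p672832); [AN]
`han : thm222_anacong_goodLattice_OPEN` from 3a-A BY NAME at both odd-`p` slices (T‴ bridge p673546 + `thm222_OPEN_of_fullDescentDatum_of_five_le`);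
the re-typed terminal consumer `GoodLatticeBDPValueOfKatzUnit.goodLatticeBDPValue_of_print_of_leTD_of_le_of_anQ_of_katzUnit_ofTate` (Prop. 3.2
hypothesis dropped) with its `μ`-input `katzUnitAll_of_anacong han ⟨thm212⟩`; [ALG-imp-λ] via `imprimLambdaLE_of_facts_tc`; the prop125 chain on
`AcTwistDeformation.prop125_residualPair_unrSelmer_corank_ge_of_facts_ofTateTC` (Milne I 5.1 at totally complex fields in the Prop. 3.2 slot); `FSideCorankLe.stub_fSideCorankLe`;
the ℚ-currency [AN] glue `anQ_of_thm222_OPEN`. CONDITIONAL on exactly these nine names; closes nothing by itself; BSD is proved for no curve.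
[claim: KellerYin2024, status: under-review]
[cite: KellerYin2024, Thm. 3.0.8 (IMC2), Thm. 1.4.1, Thms. 2.2.1–2.2.3] [cite: CastellaGrossiLeeSkinner2022, proof of Thm. 4.2.2, Thm. 5.1.3 with (disc), Thm. 2.1.2]
[cite: BleherEtAl2020, §3.3 Thm. 3.3.1] [cite: deShalit1987, II.6.4 Theorem (i)] [cite: Greenberg2016Selmer, Prop. 4.1.1, Prop. 2.6.3]
[cite: MilneADT2006, I Thm. 5.1] [cite: Harari2020, Thm. 17.13 (a), Cor. 17.14] [cite: Kriz2016, Thm. 3, Def. 31 (5), Thm. 34 (3), Thm. 35] -/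
theorem goodLatticeBDPValue_of_namedFacts₂₈
    (stub_publishedFacts :
      proofThm422_exists_isBDPLFunction_isTorsion_charIdeal_dvd ∧
        thm513_exists_isBDPLFunction_valueAtOne_disc ∧
        thm331_rubin_exists_katzMeasure₂_pseudoIso_span_eq ∧
        thmII64_katzMeasure₂_functionalEquation)
    (stub_anacongOfFullDescentDatum : thm222_anacong_goodLattice_of_fullDescentDatum)
    (stub_publishedFactsGreenberg :
      prop411_selmer_isAlmostDivisible ∧
        (∀ (L : Type) [Field L] [NumberField L] [IsTotallyComplex L],
          Literature.NumberTheory.GaloisCohomology.tateGlobalEulerPoincareCharacteristic L))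
    (stub_publishedFactsMore : prop263_sur_of_crk ∧ thm212_exists_isKatzLFunction) :
    Summit.BirchSwinnertonDyer.BirchSwinnertonDyer.Theses.EisensteinPrimes.GoodLatticeBDPValue := by
  -- seven Greenberg-type conjuncts (no Prop. 3.2), Poitou–Tate at totally complex fields (T28)
  obtain ⟨h411, h422, h5A, h41, h42, h33, hT4⟩ :=
    GoodLatticeBDPValuePublishedFactsOfTextbookTC.publishedFactsGreenberg_of_textbook_tc stub_publishedFactsGreenberg.1
      stub_publishedFactsGreenberg.2 Literature.NumberTheory.GaloisCohomology.forall_poitouTate_restricted_three_le_of_isTotallyComplex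
      (GoodLatticeBDPValueSec33OfThm331.sec33_of_thm331 stub_publishedFacts.2.2.1)
      GoodLatticeBDPValueStagesDie.weakLeopoldt_H2_subsingleton_above_cyclotomic_of_isOpen_holds
  -- [AN] at every odd `p`: 3a-A BY NAME at the datum of the closed 3a-B, and its `5 ≤ p` slice via the T‴ bridge
  have h5 : thm222_anacong_goodLattice_of_five_le :=
    GoodLatticeBDPValueFullDescentFiveLe.thm222_anacong_goodLattice_of_five_le_of_fullDescentDatum stub_anacongOfFullDescentDatum
  have han : thm222_anacong_goodLattice_OPEN :=
    GoodLatticeBDPValueAnThreeBookkeeping.thm222_OPEN_of_fullDescentDatum_of_five_le stub_anacongOfFullDescentDatum h5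
  exact GoodLatticeBDPValueOfKatzUnit.goodLatticeBDPValue_of_print_of_leTD_of_le_of_anQ_of_katzUnit_ofTate
    stub_publishedFacts.1 stub_publishedFacts.2.1 stub_publishedFacts.2.2.1 stub_publishedFacts.2.2.2
    (GoodLatticeBDPValueKatzUnitSuppliers.katzUnitAll_of_anacong han stub_publishedFactsMore.2)
    h411 h422 h5A h41 h42 h33 hT4
    (imprimLambdaLE_of_facts_tc stub_publishedFactsMore.1 stub_publishedFactsGreenberg.2
      Literature.NumberTheory.GaloisCohomology.forall_poitouTate_restricted_three_le_of_isTotallyComplex)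
    (prop125_imprimitive_of_quotient
      (prop125_quotient_of_corank (prop125_corank_of_ge
        (AcTwistDeformation.prop125_residualPair_unrSelmer_corank_ge_of_facts_ofTateTC stub_publishedFactsMore.1 h41 h42 h5A
          stub_publishedFactsGreenberg.2))))
    FSideCorankLe.stub_fSideCorankLe
    (GoodLatticeBDPValueOfNamedFactsSix.anQ_of_thm222_OPEN stub_publishedFacts.2.2.2 han stub_publishedFactsMore.2)

end Summit.BirchSwinnertonDyer.BirchSwinnertonDyer.Theorems.GoodLatticeBDPValueOfNamedFactsV28

end
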